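import Mathlib
import Summits.KontsevichZagierPeriods.Zeta5Search.BrickLevelReductionTwo

/-!
# BrickLevelReductionTwoDepth — the ONE-LEVEL REDUCTION at the prime `2` for the centre-free brick kernel AT EVERY LAURENT DEPTH `d`:
`Σ_{k≤n} g(k)·2^{(L+1)d}[T^d]F̃_k^{(n)} ≡ Σ_K W(K)·2^{Ld}[T^d]F̃_K^{(N)} [+ Σ_K G(K)·2^{Ld}[T^d]F̃_K^{(N′)}] (mod 2^{L+1})`
(cell `pub-zeta5`, seat ct-1 g45; the depth form of ct-1 g42's `BrickLevelReductionTwo`)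

HONEST FRAMING: systematic search; no irrationality claim unless certified.  INSTRUMENT congruences between weighted sums of the
local power-series coefficients `[T^d]F̃_k` (`BrickLaurent.laurent A B 0 n k d`) of the centre-free brick kernel
`R̃_n(t) = n!^{A−2B}(t−n)_n^B(t+n+1)_n^B/(t)_{n+1}^A` on two consecutive dyadic levels; nothing about `ζ(5)`/`ζ(3)`; no `γ` /
record statement; records in print UNMOVED; NOTHING IS DISCHARGED (net named-fact debt 0).  Theorems only (0 `def`).

WHY: ct-1 g42's `level_reduction_two_odd/_even` are written for the cells `c̃_{k,s} = [T^{A−s}]F̃_k`, i.e. the depths `d ≤ A`;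
their ingredients — the residue laws `BrickResidueLawTwo.residueLaw_two_*` and `BrickHoleResidueLawTwo.residueLaw_two_hat` —
already take an arbitrary depth `d`.  The REGULAR Taylor coefficients `d = A + C > A` are what Krattenthaler–Rivoal's Théorème 1
(ii) for odd `C` needs at the prime `2` (ct-1 g45's `BrickDenominatorsOddC`: `2·p_{0,C,n}(1) = −Σ_m [T^{A+C}]F_m`).

* `level_reduction_two_odd_depth` — ODD row `2N+1` (`N < 2^{L+1}`, `g ∈ ℤ_(2)`), `W = blockWeight A B 0 2 1 N g`:
  `v₂(Σ_{k<2N+2} g(k)·2^{(L+1)d}[T^d]F̃_k^{(2N+1)} − Σ_{K<N+1} W(K)·2^{Ld}[T^d]F̃_K^{(N)}) ≤ exp(−(L+1))`;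
* `level_reduction_two_even_depth` — EVEN row `2N+2` (`N+1 < 2^{L+1}`, `1 ≤ A`), `W = blockWeight A B 0 2 0 (N+1) g`,
  `G = holeWeight A B 0 2 0 N g`: the same with the hole row `N`.
The proofs are ct-1 g42's, verbatim, with `laurent … d` in place of `cell … s`.
-/

namespace Summit.KontsevichZagierPeriods.Zeta5Search.BrickLevelReductionTwoDepth

open Finset Nat Polynomial WithZero
open Summit.KontsevichZagierPeriods.Zeta5Search.BrickTopCoefficient (cTop)
open Summit.KontsevichZagierPeriods.Zeta5Search.BrickLaurent (laurent cell phiCoeff)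
open Summit.KontsevichZagierPeriods.Zeta5Search.BrickLambda (cTop_zero_ne_zero)
open Summit.KontsevichZagierPeriods.Zeta5Search.BrickLevelReduction (blockWeight)
open Summit.KontsevichZagierPeriods.Zeta5Search.BrickHoleWeight (holeWeight)
open Summit.KontsevichZagierPeriods.Zeta5Search.BrickResidueLawTwo (residueLaw_two_even residueLaw_two_odd_odd
  residueLaw_two_odd_even cTop_two_even cTop_two_odd_odd cTop_two_odd_even)
open Summit.KontsevichZagierPeriods.Zeta5Search.BrickHoleResidueLawTwo (residueLaw_two_hat cTop_two_hat)
open Summit.KontsevichZagierPeriods.Zeta5Search.BrickLevelReductionTwo (sum_range_even_odd sum_range_even_odd_succ term_le)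

noncomputable section

/-! ## Odd row `2N+1`: ° cells only -/

section odd

variable {A B : ℕ} (hAB : 2 * B ≤ A) (hB : 1 ≤ B) {L N : ℕ} (hN : N < 2 ^ (L + 1)) {g : ℕ → ℚ}
  (hg : ∀ k, k ≤ 2 * N + 1 → Rat.padicValuation 2 (g k) ≤ 1)
include hAB hB hN hg

/-- **ONE-LEVEL REDUCTION at `2`, odd row, depth `d`**: with `W = blockWeight A B 0 2 1 N g` (the row `2N+1 = 1 + N·2`),
`v₂(Σ_{k<2N+2} g(k)·2^{(L+1)d}[T^d]F̃_k^{(2N+1)} − Σ_{K<N+1} W(K)·2^{Ld}[T^d]F̃_K^{(N)}) ≤ exp(−(L+1))`. -/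
theorem level_reduction_two_odd_depth (d : ℕ) :
    Rat.padicValuation 2 (∑ k ∈ range (2 * N + 1 + 1), g k * ((2 : ℚ) ^ ((L + 1) * d) * laurent A B 0 (2 * N + 1) k d) -
      ∑ K ∈ range (N + 1), blockWeight A B 0 2 1 N g K * ((2 : ℚ) ^ (L * d) * laurent A B 0 N K d)) ≤
      exp (-((L : ℤ) + 1)) := by
  rw [sum_range_even_odd, ← Finset.sum_add_distrib, ← Finset.sum_sub_distrib]
  refine Valuation.map_sum_le _ fun K hK => ?_
  have hKN : K ≤ N := Nat.lt_succ_iff.1 (mem_range.1 hK)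
  have hc0 : cTop A B 0 N K ≠ 0 := cTop_zero_ne_zero hKN A B
  -- the block weight at `K`: two digits `k₀ = 0, 1`
  have hW : blockWeight A B 0 2 1 N g K =
      g (2 * K) * (cTop A B 0 (2 * N + 1) (2 * K) / cTop A B 0 N K) +
        g (2 * K + 1) * (cTop A B 0 (2 * N + 1) (2 * K + 1) / cTop A B 0 N K) := by
    rw [blockWeight, Finset.sum_range_succ, Finset.sum_range_one, zero_add, show 1 + N * 2 = 2 * N + 1 by ring,
      show K * 2 = 2 * K by ring, show 1 + 2 * K = 2 * K + 1 by ring]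
  rw [hW, cTop_two_odd_even hAB hKN, cTop_two_odd_odd hAB hKN, mul_div_cancel_right₀ _ hc0, mul_div_cancel_right₀ _ hc0]
  have he := residueLaw_two_odd_even hAB hB hN hKN d
  have ho := residueLaw_two_odd_odd hAB hB hN hKN d
  have hge : Rat.padicValuation 2 (g (2 * K)) ≤ 1 := hg _ (by omega)
  have hgo : Rat.padicValuation 2 (g (2 * K + 1)) ≤ 1 := hg _ (by omega)
  have h1 := term_le hge he
  have h2 := term_le hgo ho
  rw [show ∀ (a b c e f : ℚ), a + b - (c + e) * f = (a - c * f) + (b - e * f) from fun a b c e f => by ring]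
  exact (Valuation.map_add _ _ _).trans (max_le h1 h2)

end odd

/-! ## Even row `2N+2`: ° cells to the row `N+1`, holes to the row `N` -/

section even

variable {A B : ℕ} (hAB : 2 * B ≤ A) {L N : ℕ} (hN : N + 1 < 2 ^ (L + 1)) {g : ℕ → ℚ}
  (hg : ∀ k, k ≤ 2 * N + 2 → Rat.padicValuation 2 (g k) ≤ 1)
include hAB hN hg

/-- **ONE-LEVEL REDUCTION at `2`, even row, depth `d`**: with `W = blockWeight A B 0 2 0 (N+1) g` (row `2N+2 = 0 + (N+1)·2`)
and `G = holeWeight A B 0 2 0 N g`, for `N + 1 < 2^{L+1}`, `1 ≤ A`: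
`v₂(Σ_{k<2N+3} g(k)·2^{(L+1)d}[T^d]F̃_k^{(2N+2)} − Σ_{K<N+2} W(K)·2^{Ld}[T^d]F̃_K^{(N+1)} − Σ_{K<N+1} G(K)·2^{Ld}[T^d]F̃_K^{(N)})
≤ exp(−(L+1))`. -/
theorem level_reduction_two_even_depth (hA : 1 ≤ A) (d : ℕ) :
    Rat.padicValuation 2 (∑ k ∈ range (2 * N + 2 + 1), g k * ((2 : ℚ) ^ ((L + 1) * d) * laurent A B 0 (2 * N + 2) k d) -
      ∑ K ∈ range (N + 1 + 1), blockWeight A B 0 2 0 (N + 1) g K * ((2 : ℚ) ^ (L * d) * laurent A B 0 (N + 1) K d) -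
      ∑ K ∈ range (N + 1), holeWeight A B 0 2 0 N g K * ((2 : ℚ) ^ (L * d) * laurent A B 0 N K d)) ≤
      exp (-((L : ℤ) + 1)) := by
  have hN' : N < 2 ^ (L + 1) := by omega
  rw [sum_range_even_odd_succ, show ∀ (a b c e : ℚ), a + b - c - e = (a - c) + (b - e) from fun a b c e => by ring,
    ← Finset.sum_sub_distrib, ← Finset.sum_sub_distrib]
  refine (Valuation.map_add _ _ _).trans (max_le (Valuation.map_sum_le _ fun K hK => ?_)
    (Valuation.map_sum_le _ fun K hK => ?_))
  · -- ° cell `2K` against the row `N+1`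
    have hKN : K ≤ N + 1 := Nat.lt_succ_iff.1 (mem_range.1 hK)
    have hc0 : cTop A B 0 (N + 1) K ≠ 0 := cTop_zero_ne_zero hKN A B
    have hW : blockWeight A B 0 2 0 (N + 1) g K = g (2 * K) * (cTop A B 0 ((N + 1) * 2) (K * 2) / cTop A B 0 (N + 1) K) := by
      rw [blockWeight, Finset.sum_range_one, zero_add, zero_add, show K * 2 = 2 * K by ring]
    rw [hW, cTop_two_even hAB hKN, mul_div_cancel_right₀ _ hc0]
    have he := residueLaw_two_even hAB hN hKN d
    rw [show (N + 1) * 2 = 2 * N + 2 by ring, show K * 2 = 2 * K by ring] at he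
    exact term_le (hg (2 * K) (by omega)) he
  · -- hole `2K+1` against the row `N`
    have hKN : K ≤ N := Nat.lt_succ_iff.1 (mem_range.1 hK)
    have hc0 : cTop A B 0 N K ≠ 0 := cTop_zero_ne_zero hKN A B
    have hG : holeWeight A B 0 2 0 N g K = g (2 * K + 1) * (cTop A B 0 (2 * N + 2) (2 * K + 1) / cTop A B 0 N K) := by
      rw [holeWeight, zero_add, Nat.Ico_succ_singleton, Finset.sum_singleton, zero_add, show (N + 1) * 2 = 2 * N + 2 by ring,
        show 1 + K * 2 = 2 * K + 1 by ring]
    rw [hG, cTop_two_hat hAB hKN, mul_div_cancel_right₀ _ hc0]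
    exact term_le (hg (2 * K + 1) (by omega)) (residueLaw_two_hat hAB hN' hKN hA d)

end even

end

end Summit.KontsevichZagierPeriods.Zeta5Search.BrickLevelReductionTwoDepth
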